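import Mathlib.Analysis.SpecialFunctions.ImproperIntegrals
import Mathlib.Analysis.SpecialFunctions.Trigonometric.ArctanDeriv
import Mathlib.Analysis.SpecialFunctions.Log.Deriv
import Mathlib.MeasureTheory.Integral.IntegralEqImproper
import Mathlib.Topology.Algebra.Order.Field
import HarnessLib

/-!
# The Hilbert transform on the line: the operator and its two classical closed forms

Topic `Literature/Analysis/Fourier`. For `f : ℝ → ℝ` the **Hilbert transform** in its principal-value
symmetric form

  `Hf(x) = π⁻¹ p.v.∫ f(y)/(x − y) dy = π⁻¹ ∫_{t>0} (f(x − t) − f(x + t))/t dt`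

(the right-hand side is absolutely convergent for `f` Lipschitz near `x` and `O(|y|⁻¹⁻ᵋ)` at infinity,
and is the form used throughout: Stein, *Singular integrals* (1970), Ch. II §§1–2; King, *Hilbert
transforms* Vol. 1 (2009), Ch. 3 — background only). With this kernel `H cos = sin`, `H sin = −cos`, the Fourier
multiplier is `−i·sgn k`, and for `g` holomorphic and decaying in the upper half-plane
`H(Re g) = Im g` on `ℝ`; it is the convention `u_x = Hω` of the Constantin–Lax–Majda /
Okamoto–Sakajo–Wunsch model equations.

We introduce ONE definition, `hilbertTransform`, and prove:

* `hilbertTransform_inv_one_add_sq` — **`H[(1+y²)⁻¹](x) = x/(1+x²)`** (the Poisson / conjugate-Poisson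
  pair at height `1`), and its dilate `hilbertTransform_poissonKernel`: `H[L/(L²+y²)] = x/(L²+x²)`;
* `hilbertTransform_div_one_add_sq_sq` — **`H[y/(1+y²)²](x) = (x² − 1)/(2(1+x²)²)`** (the boundary
  values of `g(z) = i/(2(z+i)²)`: `Re g = y/(1+y²)²`, `Im g = (y²−1)/(2(1+y²)²)`); this is the test pair
  of the 1-D profile-sheet computations and the cited closed form `hilbProfile` of
  `Summits/NavierStokesRegularity/OSWSelfSimilar/SheetRowThirdExactFamily.lean`;
* the structural rules that need no integrability hypothesis: homogeneity
  (`hilbertTransform_const_mul`, `hilbertTransform_neg`), translation covariance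
  (`hilbertTransform_comp_sub_const`), covariance under positive dilations
  (`hilbertTransform_comp_div`, `hilbertTransform_comp_mul`), and parity (`f` odd ⇒ `Hf` even,
  `f` even ⇒ `Hf` odd);
* additivity under integrability of the two symmetric integrands (`hilbertTransform_add`).

Both closed forms are obtained from explicit primitives (arctangent + logarithm + rational) of the
symmetric integrands, which are the rational functions `4x/((1+(x−t)²)(1+(x+t)²))` and
`−2(AB + 2x(t−x)B − 2x(t+x)A)/(A²B²)`, `A = 1+(x−t)²`, `B = 1+(x+t)²`, dominated by `C/(1+t²)`.
All statements are classical. [cite: Grafakos2014, Def. 5.1.1, Rmk. 5.1.2, eq. (5.1.17), Ex. 5.1.8, Ex. 5.1.11(a)]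
[cite: AmbroseLushnikovSiegelSilantyev2024, §5.2] (Stein, *Singular integrals*, Ch. II–III is the
other standard reference.)
-/

namespace Literature.Analysis.Fourier

open _root_.MeasureTheory Set Filter
open scoped Real Topology

/-! ### The operator -/

/-- The **Hilbert transform on `ℝ`** in principal-value symmetric form,
`Hf(x) = π⁻¹ ∫_{t>0} (f(x−t) − f(x+t))/t dt = π⁻¹ p.v.∫ f(y)/(x−y) dy`
(convention `H cos = sin`, `H sin = −cos`; Fourier multiplier `−i sgn k`). For integrands that are not
integrable on `(0,∞)` the Bochner integral returns `0`, so every closed-form statement below carries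
(and proves) the integrability it needs.
[cite: Grafakos2014, Def. 5.1.1 with Rmk. 5.1.2 (eqs. (5.1.3)–(5.1.5), folded onto `t > 0`)] -/
noncomputable def hilbertTransform (f : ℝ → ℝ) (x : ℝ) : ℝ :=
  π⁻¹ * ∫ t in Ioi (0 : ℝ), (f (x - t) - f (x + t)) / t

/-! ### Structural rules (no integrability needed) -/

/-- Homogeneity: `H(c·f) = c·Hf`. [cite: Grafakos2014, Def. 5.1.1 (linearity) and Ex. 5.1.11(a) (translations, dilations, reflection)] -/
theorem hilbertTransform_const_mul (c : ℝ) (f : ℝ → ℝ) (x : ℝ) :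
    hilbertTransform (fun y => c * f y) x = c * hilbertTransform f x := by
  unfold hilbertTransform
  have h : (fun t : ℝ => (c * f (x - t) - c * f (x + t)) / t) =
      fun t : ℝ => c * ((f (x - t) - f (x + t)) / t) := by
    funext t
    ring
  rw [h, integral_const_mul]
  ring

/-- `H(−f) = −Hf`. [cite: Grafakos2014, Def. 5.1.1 (linearity) and Ex. 5.1.11(a) (translations, dilations, reflection)] -/
theorem hilbertTransform_neg (f : ℝ → ℝ) (x : ℝ) :
    hilbertTransform (fun y => -f y) x = -hilbertTransform f x := by
  have h := hilbertTransform_const_mul (-1) f x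
  simp only [neg_mul, one_mul] at h
  exact h

/-- Translation covariance: `H[f(· − c)](x) = (Hf)(x − c)`. [cite: Grafakos2014, Def. 5.1.1 (linearity) and Ex. 5.1.11(a) (translations, dilations, reflection)] -/
theorem hilbertTransform_comp_sub_const (f : ℝ → ℝ) (c x : ℝ) :
    hilbertTransform (fun y => f (y - c)) x = hilbertTransform f (x - c) := by
  unfold hilbertTransform
  simp only [sub_right_comm x _ c, add_sub_right_comm x _ c]

/-- Covariance under positive dilations: `H[f(·/ℓ)](x) = (Hf)(x/ℓ)` for `ℓ > 0` (the Hilbert transform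
commutes with the dilation group). [cite: Grafakos2014, Def. 5.1.1 (linearity) and Ex. 5.1.11(a) (translations, dilations, reflection)] -/
theorem hilbertTransform_comp_div (f : ℝ → ℝ) {ℓ : ℝ} (hℓ : 0 < ℓ) (x : ℝ) :
    hilbertTransform (fun y => f (y / ℓ)) x = hilbertTransform f (x / ℓ) := by
  unfold hilbertTransform
  congr 1
  set ψ : ℝ → ℝ := fun s => (f (x / ℓ - s) - f (x / ℓ + s)) / s with hψ
  have hℓ0 : ℓ ≠ 0 := hℓ.ne'
  have hpt : ∀ t : ℝ, (f ((x - t) / ℓ) - f ((x + t) / ℓ)) / t = ℓ⁻¹ * ψ (ℓ⁻¹ * t) := by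
    intro t
    have e1 : (x - t) / ℓ = x / ℓ - ℓ⁻¹ * t := by ring
    have e2 : (x + t) / ℓ = x / ℓ + ℓ⁻¹ * t := by ring
    rw [hψ]
    simp only [e1, e2]
    rw [← mul_div_assoc, mul_div_mul_left _ _ (inv_ne_zero hℓ0)]
  simp_rw [hpt]
  rw [integral_const_mul, integral_comp_mul_left_Ioi ψ 0 (inv_pos.2 hℓ), mul_zero, inv_inv,
    smul_eq_mul, ← mul_assoc, inv_mul_cancel₀ hℓ0, one_mul]

/-- Covariance under positive dilations, multiplicative form: `H[f(k·)](x) = (Hf)(k x)` for `k > 0`.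
[cite: Grafakos2014, Def. 5.1.1 (linearity) and Ex. 5.1.11(a) (translations, dilations, reflection)] -/
theorem hilbertTransform_comp_mul (f : ℝ → ℝ) {k : ℝ} (hk : 0 < k) (x : ℝ) :
    hilbertTransform (fun y => f (k * y)) x = hilbertTransform f (k * x) := by
  have h := hilbertTransform_comp_div f (inv_pos.2 hk) x
  simp only [div_inv_eq_mul, mul_comm _ k] at h
  exact h

/-- Parity: the Hilbert transform of an odd function is even. [cite: Grafakos2014, Def. 5.1.1 (linearity) and Ex. 5.1.11(a) (translations, dilations, reflection)] -/
theorem hilbertTransform_neg_arg_of_odd {f : ℝ → ℝ} (hf : ∀ y, f (-y) = -f y) (x : ℝ) :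
    hilbertTransform f (-x) = hilbertTransform f x := by
  unfold hilbertTransform
  congr 1
  refine integral_congr_ae (Eventually.of_forall fun t => ?_)
  have e1 : -x - t = -(x + t) := by ring
  have e2 : -x + t = -(x - t) := by ring
  simp only [e1, e2, hf]
  ring

/-- Parity: the Hilbert transform of an even function is odd. [cite: Grafakos2014, Def. 5.1.1 (linearity) and Ex. 5.1.11(a) (translations, dilations, reflection)] -/
theorem hilbertTransform_neg_arg_of_even {f : ℝ → ℝ} (hf : ∀ y, f (-y) = f y) (x : ℝ) :
    hilbertTransform f (-x) = -hilbertTransform f x := by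
  unfold hilbertTransform
  rw [← mul_neg, ← integral_neg]
  congr 1
  refine integral_congr_ae (Eventually.of_forall fun t => ?_)
  have e1 : -x - t = -(x + t) := by ring
  have e2 : -x + t = -(x - t) := by ring
  simp only [e1, e2, hf]
  ring

/-- Additivity, under integrability of the two symmetric integrands on `(0, ∞)`. [cite: Grafakos2014, Def. 5.1.1 (linearity) and Ex. 5.1.11(a) (translations, dilations, reflection)] -/
theorem hilbertTransform_add {f g : ℝ → ℝ} {x : ℝ}
    (hf : IntegrableOn (fun t => (f (x - t) - f (x + t)) / t) (Ioi 0))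
    (hg : IntegrableOn (fun t => (g (x - t) - g (x + t)) / t) (Ioi 0)) :
    hilbertTransform (fun y => f y + g y) x = hilbertTransform f x + hilbertTransform g x := by
  unfold hilbertTransform
  rw [← mul_add, ← integral_add hf hg]
  congr 1
  refine integral_congr_ae (Eventually.of_forall fun t => ?_)
  simp only
  ring

/-! ### Two elementary bounds and three elementary limits -/

/-- `(1+(x−t)²)(1+(x+t)²) ≥ 1 + t²`. [folklore] -/
private theorem one_add_sq_le_prod (x t : ℝ) : 1 + t ^ 2 ≤ (1 + (x - t) ^ 2) * (1 + (x + t) ^ 2) := by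
  nlinarith [sq_nonneg x, sq_nonneg t, sq_nonneg (x ^ 2 - t ^ 2), sq_nonneg (x * t)]

/-- `|s| ≤ 1 + s²`. [folklore] -/
private theorem abs_le_one_add_sq (s : ℝ) : |s| ≤ 1 + s ^ 2 := by
  cases le_or_gt 0 s with
  | inl h => rw [abs_of_nonneg h]; nlinarith [sq_nonneg (s - 1)]
  | inr h => rw [abs_of_neg h]; nlinarith [sq_nonneg (s + 1)]

/-- `arctan (t + c) → π/2` as `t → +∞`. [folklore] -/
private theorem tendsto_arctan_add_const_atTop (c : ℝ) :
    Tendsto (fun t : ℝ => Real.arctan (t + c)) atTop (𝓝 (π / 2)) :=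
  (Real.tendsto_arctan_atTop.mono_right nhdsWithin_le_nhds).comp
    (tendsto_atTop_add_const_right atTop c tendsto_id)

/-- `(t + c)/(1 + (t + c')²)`-type terms vanish at `+∞`: `(x + t)/(1+(x+t)²) → 0`. [folklore] -/
private theorem tendsto_lin_div_one_add_sq_atTop (x : ℝ) :
    Tendsto (fun t : ℝ => (x + t) / (1 + (x + t) ^ 2)) atTop (𝓝 0) := by
  have h1 : Tendsto (fun t : ℝ => (x + t)⁻¹) atTop (𝓝 0) :=
    tendsto_inv_atTop_zero.comp (tendsto_atTop_add_const_left atTop x tendsto_id)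
  refine squeeze_zero_norm' ?_ h1
  filter_upwards [eventually_gt_atTop (-x)] with t ht
  have hs : 0 < x + t := by linarith
  rw [Real.norm_eq_abs, abs_of_nonneg (div_nonneg hs.le (by positivity)), div_le_iff₀ (by positivity),
    inv_mul_eq_div, le_div_iff₀ hs]
  nlinarith [sq_nonneg (x + t)]

/-- `(x − t)/(1+(x−t)²) → 0` as `t → +∞`. [folklore] -/
private theorem tendsto_lin_div_one_add_sq_atTop' (x : ℝ) :
    Tendsto (fun t : ℝ => (x - t) / (1 + (x - t) ^ 2)) atTop (𝓝 0) := by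
  have h := (tendsto_lin_div_one_add_sq_atTop (-x)).neg
  rw [neg_zero] at h
  refine h.congr fun t => ?_
  have e : (-x + t) ^ 2 = (x - t) ^ 2 := by ring
  rw [e, ← neg_div]
  ring

/-- `1/(1+(x+t)²) → 0` as `t → +∞`. [folklore] -/
private theorem tendsto_inv_one_add_sq_shift_atTop (x : ℝ) :
    Tendsto (fun t : ℝ => (1 + (x + t) ^ 2)⁻¹) atTop (𝓝 0) := by
  refine tendsto_inv_atTop_zero.comp ?_
  refine tendsto_atTop_add_const_left atTop 1 ?_
  exact (tendsto_pow_atTop two_ne_zero).comp (tendsto_atTop_add_const_left atTop x tendsto_id)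

/-- `1/(1+(x−t)²) → 0` as `t → +∞`. [folklore] -/
private theorem tendsto_inv_one_add_sq_shift_atTop' (x : ℝ) :
    Tendsto (fun t : ℝ => (1 + (x - t) ^ 2)⁻¹) atTop (𝓝 0) := by
  refine (tendsto_inv_one_add_sq_shift_atTop (-x)).congr fun t => ?_
  have e : (-x + t) ^ 2 = (x - t) ^ 2 := by ring
  rw [e]

/-- The logarithmic part of the primitives vanishes at infinity:
`log(1+(x+t)²) − log(1+(x−t)²) → 0` as `t → +∞`. [folklore] -/
private theorem tendsto_log_sub_log_atTop (x : ℝ) :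
    Tendsto (fun t : ℝ => Real.log (1 + (x + t) ^ 2) - Real.log (1 + (x - t) ^ 2)) atTop (𝓝 0) := by
  -- `B/A = 1 + 4xt/A → 1`, and `log` is continuous at `1`.
  have hq : Tendsto (fun t : ℝ => 4 * x * t / (1 + (x - t) ^ 2)) atTop (𝓝 0) := by
    have h1 : Tendsto (fun t : ℝ => 16 * |x| * t⁻¹) atTop (𝓝 0) := by
      simpa using tendsto_inv_atTop_zero.const_mul (16 * |x|)
    refine squeeze_zero_norm' ?_ h1
    filter_upwards [eventually_ge_atTop (2 * |x|), eventually_gt_atTop (0 : ℝ)] with t ht ht0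
    have hA : 0 < 1 + (x - t) ^ 2 := by positivity
    rw [Real.norm_eq_abs, abs_div, abs_of_pos hA, div_le_iff₀ hA, abs_mul, abs_mul,
      abs_of_pos ht0, abs_of_pos (by norm_num : (0:ℝ) < 4)]
    -- `4|x| t · t ≤ 16|x| (1+(x−t)²)` since `t ≤ 2|t − x|` when `t ≥ 2|x|`.
    have hxt : t ^ 2 ≤ 4 * (1 + (x - t) ^ 2) := by
      have hx' : |x| ≤ t / 2 := by linarith
      have h2 : t / 2 ≤ |x - t| := by
        have := abs_sub_abs_le_abs_sub t x
        rw [abs_of_pos ht0, abs_sub_comm] at this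
        linarith
      have h3 : (t / 2) ^ 2 ≤ (x - t) ^ 2 := by
        rw [← sq_abs (x - t)]
        exact pow_le_pow_left₀ (by linarith) h2 2
      nlinarith
    have hx0 : 0 ≤ |x| := abs_nonneg x
    have ht0' : t ≠ 0 := ht0.ne'
    calc 4 * |x| * t = 16 * |x| * t⁻¹ * (t ^ 2 / 4) := by field_simp; ring
      _ ≤ 16 * |x| * t⁻¹ * (1 + (x - t) ^ 2) := by
          gcongr
          linarith
  have hratio : Tendsto (fun t : ℝ => (1 + (x + t) ^ 2) / (1 + (x - t) ^ 2)) atTop (𝓝 1) := by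
    have h := tendsto_const_nhds (x := (1 : ℝ)) (f := (atTop : Filter ℝ)) |>.add hq
    rw [add_zero] at h
    refine h.congr fun t => ?_
    have hA : (1 + (x - t) ^ 2) ≠ 0 := by positivity
    field_simp
    ring
  have hlog := (hratio.log one_ne_zero)
  rw [Real.log_one] at hlog
  refine hlog.congr fun t => ?_
  rw [Real.log_div (by positivity) (by positivity)]

/-! ### `H[(1+y²)⁻¹] = x/(1+x²)` -/

/-- The symmetric integrand of `H[(1+y²)⁻¹]` at `x` is the rational function
`4x/((1+(x−t)²)(1+(x+t)²))` (for `t ≠ 0`). [folklore] -/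
private theorem poisson_symm_integrand (x : ℝ) {t : ℝ} (ht : t ≠ 0) :
    ((1 + (x - t) ^ 2)⁻¹ - (1 + (x + t) ^ 2)⁻¹) / t =
      4 * x / ((1 + (x - t) ^ 2) * (1 + (x + t) ^ 2)) := by
  have hA : (1 + (x - t) ^ 2) ≠ 0 := by positivity
  have hB : (1 + (x + t) ^ 2) ≠ 0 := by positivity
  field_simp
  ring

/-- The rational integrand `4x/((1+(x−t)²)(1+(x+t)²))` is integrable on `ℝ` (dominated by
`4|x|/(1+t²)`). [folklore] -/
private theorem integrable_poisson_symm_integrand (x : ℝ) :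
    Integrable fun t : ℝ => 4 * x / ((1 + (x - t) ^ 2) * (1 + (x + t) ^ 2)) := by
  refine Integrable.mono' (integrable_inv_one_add_sq.const_mul (4 * |x|)) ?_ ?_
  · refine Continuous.aestronglyMeasurable ?_
    refine Continuous.div (by fun_prop) (by fun_prop) fun t => ?_
    positivity
  · refine Eventually.of_forall fun t => ?_
    have hP : 0 < (1 + (x - t) ^ 2) * (1 + (x + t) ^ 2) := by positivity
    rw [Real.norm_eq_abs, abs_div, abs_of_pos hP, abs_mul, abs_of_pos (by norm_num : (0:ℝ) < 4),
      ← div_eq_mul_inv]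
    exact div_le_div_of_nonneg_left (by positivity) (by positivity) (one_add_sq_le_prod x t)

/-- The primitive of the Poisson symmetric integrand:
`G(t) = (log(1+(x+t)²) − log(1+(x−t)²))/(2(1+x²)) + x (arctan(t−x) + arctan(t+x))/(1+x²)`
has derivative `4x/((1+(x−t)²)(1+(x+t)²))`. [folklore] -/
private theorem hasDerivAt_poisson_primitive (x t : ℝ) :
    HasDerivAt (fun t : ℝ => (Real.log (1 + (x + t) ^ 2) - Real.log (1 + (x - t) ^ 2)) / (2 * (1 + x ^ 2))
        + x / (1 + x ^ 2) * (Real.arctan (t - x) + Real.arctan (t + x)))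
      (4 * x / ((1 + (x - t) ^ 2) * (1 + (x + t) ^ 2))) t := by
  have hA : 0 < 1 + (x - t) ^ 2 := by positivity
  have hB : 0 < 1 + (x + t) ^ 2 := by positivity
  have hc : (1 + x ^ 2) ≠ 0 := by positivity
  -- pieces
  have dB : HasDerivAt (fun t : ℝ => 1 + (x + t) ^ 2) (2 * (x + t)) t := by
    have h := ((hasDerivAt_id' t).const_add x).pow 2
    have h' := h.const_add 1
    refine h'.congr_deriv ?_
    push_cast
    ring
  have dA : HasDerivAt (fun t : ℝ => 1 + (x - t) ^ 2) (-(2 * (x - t))) t := by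
    have h := ((hasDerivAt_id' t).const_sub x).pow 2
    have h' := h.const_add 1
    refine h'.congr_deriv ?_
    push_cast
    ring
  have dlogB : HasDerivAt (fun t : ℝ => Real.log (1 + (x + t) ^ 2)) (2 * (x + t) / (1 + (x + t) ^ 2)) t :=
    dB.log hB.ne'
  have dlogA : HasDerivAt (fun t : ℝ => Real.log (1 + (x - t) ^ 2))
      (-(2 * (x - t)) / (1 + (x - t) ^ 2)) t := dA.log hA.ne'
  have dat1 : HasDerivAt (fun t : ℝ => Real.arctan (t - x)) (1 / (1 + (t - x) ^ 2) * 1) t :=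
    ((hasDerivAt_id' t).sub_const x).arctan
  have dat2 : HasDerivAt (fun t : ℝ => Real.arctan (t + x)) (1 / (1 + (t + x) ^ 2) * 1) t :=
    ((hasDerivAt_id' t).add_const x).arctan
  have hsum := ((dlogB.sub dlogA).div_const (2 * (1 + x ^ 2))).add ((dat1.add dat2).const_mul (x / (1 + x ^ 2)))
  refine hsum.congr_deriv ?_
  have e1 : (t - x) ^ 2 = (x - t) ^ 2 := by ring
  have e2 : (t + x) ^ 2 = (x + t) ^ 2 := by ring
  rw [e1, e2]
  field_simp
  ring

/-- **`H[(1+y²)⁻¹](x) = x/(1+x²)`**: the Hilbert transform of the Poisson kernel at height `1` is the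
conjugate Poisson kernel (boundary values of `i/(z+i)`: real part `1/(1+y²)`, imaginary part
`y/(1+y²)`). [cite: Grafakos2014, Ex. 5.1.8 (`H(P_y) = Q_y`) at `y = 1`, with eq. (5.1.17)] -/
theorem hilbertTransform_inv_one_add_sq (x : ℝ) :
    hilbertTransform (fun y => (1 + y ^ 2)⁻¹) x = x / (1 + x ^ 2) := by
  unfold hilbertTransform
  have hcongr : ∫ t in Ioi (0:ℝ), ((1 + (x - t) ^ 2)⁻¹ - (1 + (x + t) ^ 2)⁻¹) / t =
      ∫ t in Ioi (0:ℝ), 4 * x / ((1 + (x - t) ^ 2) * (1 + (x + t) ^ 2)) :=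
    setIntegral_congr_fun measurableSet_Ioi fun t ht => poisson_symm_integrand x (ne_of_gt ht)
  rw [hcongr]
  set G : ℝ → ℝ := fun t => (Real.log (1 + (x + t) ^ 2) - Real.log (1 + (x - t) ^ 2)) / (2 * (1 + x ^ 2))
        + x / (1 + x ^ 2) * (Real.arctan (t - x) + Real.arctan (t + x)) with hG
  have hlim : Tendsto G atTop (𝓝 (0 / (2 * (1 + x ^ 2)) + x / (1 + x ^ 2) * (π / 2 + π / 2))) := by
    refine Tendsto.add ?_ ?_
    · exact (tendsto_log_sub_log_atTop x).div_const _
    · refine Tendsto.const_mul _ (Tendsto.add ?_ ?_)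
      · simpa [sub_eq_add_neg] using tendsto_arctan_add_const_atTop (-x)
      · exact tendsto_arctan_add_const_atTop x
  have hFTC := integral_Ioi_of_hasDerivAt_of_tendsto' (f := G) (a := 0)
    (fun t _ => hasDerivAt_poisson_primitive x t)
    (integrable_poisson_symm_integrand x).integrableOn hlim
  rw [hFTC]
  have hG0 : G 0 = 0 := by
    simp only [hG, add_zero, sub_zero, zero_sub, zero_add, Real.arctan_neg, neg_add_cancel, mul_zero,
      sub_self, zero_div]
  rw [hG0]
  have hc : (1 + x ^ 2) ≠ 0 := by positivity
  field_simp
  ring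

/-- **The Poisson kernel at height `L > 0`**: `H[L/(L²+y²)](x) = x/(L²+x²)` (conjugate Poisson
kernel), by dilation from height `1`. [cite: Grafakos2014, Ex. 5.1.8 (`H(P_y) = Q_y`), eq. (5.1.17)] -/
theorem hilbertTransform_poissonKernel {L : ℝ} (hL : 0 < L) (x : ℝ) :
    hilbertTransform (fun y => L / (L ^ 2 + y ^ 2)) x = x / (L ^ 2 + x ^ 2) := by
  have hL0 : L ≠ 0 := hL.ne'
  have hfun : (fun y : ℝ => L / (L ^ 2 + y ^ 2)) = fun y => L⁻¹ * (1 + (y / L) ^ 2)⁻¹ := by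
    funext y
    have : L ^ 2 + y ^ 2 ≠ 0 := by positivity
    field_simp
  rw [hfun, hilbertTransform_const_mul,
    hilbertTransform_comp_div (fun y : ℝ => (1 + y ^ 2)⁻¹) hL x, hilbertTransform_inv_one_add_sq]
  have : L ^ 2 + x ^ 2 ≠ 0 := by positivity
  field_simp

/-! ### `H[y/(1+y²)²] = (x²−1)/(2(1+x²)²)` -/

/-- The symmetric integrand of `H[y/(1+y²)²]` at `x` is the rational function
`−2(AB + 2x(t−x)B − 2x(x+t)A)/(A²B²)` with `A = 1+(x−t)²`, `B = 1+(x+t)²` (for `t ≠ 0`). [folklore] -/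
private theorem doublePole_symm_integrand (x : ℝ) {t : ℝ} (ht : t ≠ 0) :
    ((x - t) / (1 + (x - t) ^ 2) ^ 2 - (x + t) / (1 + (x + t) ^ 2) ^ 2) / t =
      -2 * ((1 + (x - t) ^ 2) * (1 + (x + t) ^ 2) + 2 * x * (t - x) * (1 + (x + t) ^ 2)
              - 2 * x * (x + t) * (1 + (x - t) ^ 2))
        / ((1 + (x - t) ^ 2) ^ 2 * (1 + (x + t) ^ 2) ^ 2) := by
  have hA : (1 + (x - t) ^ 2) ≠ 0 := by positivity
  have hB : (1 + (x + t) ^ 2) ≠ 0 := by positivity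
  field_simp
  ring

/-- The rational integrand of `H[y/(1+y²)²]` is integrable on `ℝ` (dominated by `2(1+4|x|)/(1+t²)`).
[folklore] -/
private theorem integrable_doublePole_symm_integrand (x : ℝ) :
    Integrable fun t : ℝ =>
      -2 * ((1 + (x - t) ^ 2) * (1 + (x + t) ^ 2) + 2 * x * (t - x) * (1 + (x + t) ^ 2)
              - 2 * x * (x + t) * (1 + (x - t) ^ 2))
        / ((1 + (x - t) ^ 2) ^ 2 * (1 + (x + t) ^ 2) ^ 2) := by
  refine Integrable.mono' (integrable_inv_one_add_sq.const_mul (2 * (1 + 4 * |x|))) ?_ ?_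
  · refine Continuous.aestronglyMeasurable ?_
    refine Continuous.div (by fun_prop) (by fun_prop) fun t => ?_
    positivity
  · refine Eventually.of_forall fun t => ?_
    set A := 1 + (x - t) ^ 2 with hAdef
    set B := 1 + (x + t) ^ 2 with hBdef
    have hA : 0 < A := by positivity
    have hB : 0 < B := by positivity
    have hAB : 1 + t ^ 2 ≤ A * B := one_add_sq_le_prod x t
    -- numerator bound: |AB + 2x(t−x)B − 2x(x+t)A| ≤ (1 + 4|x|)·A·B
    have h1 : |t - x| ≤ A := by
      have := abs_le_one_add_sq (x - t)
      rwa [abs_sub_comm] at this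
    have h2 : |x + t| ≤ B := abs_le_one_add_sq (x + t)
    have hnum : |A * B + 2 * x * (t - x) * B - 2 * x * (x + t) * A| ≤ (1 + 4 * |x|) * (A * B) := by
      calc |A * B + 2 * x * (t - x) * B - 2 * x * (x + t) * A|
          ≤ |A * B + 2 * x * (t - x) * B| + |2 * x * (x + t) * A| := abs_sub _ _
        _ ≤ |A * B| + |2 * x * (t - x) * B| + |2 * x * (x + t) * A| := by
            gcongr
            exact abs_add_le _ _
        _ = A * B + 2 * |x| * |t - x| * B + 2 * |x| * |x + t| * A := by
            rw [abs_of_pos (mul_pos hA hB), abs_mul, abs_mul, abs_mul, abs_of_pos hB, abs_mul, abs_mul,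
              abs_mul, abs_of_pos hA, abs_of_pos (by norm_num : (0:ℝ) < 2)]
        _ ≤ A * B + 2 * |x| * A * B + 2 * |x| * B * A := by
            gcongr
        _ = (1 + 4 * |x|) * (A * B) := by ring
    rw [Real.norm_eq_abs, abs_div, abs_mul, abs_of_pos (by positivity : (0:ℝ) < A ^ 2 * B ^ 2)]
    rw [show |(-2 : ℝ)| = 2 by norm_num]
    calc 2 * |A * B + 2 * x * (t - x) * B - 2 * x * (x + t) * A| / (A ^ 2 * B ^ 2)
        ≤ 2 * ((1 + 4 * |x|) * (A * B)) / (A ^ 2 * B ^ 2) := by gcongr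
      _ = 2 * (1 + 4 * |x|) / (A * B) := by field_simp
      _ ≤ 2 * (1 + 4 * |x|) / (1 + t ^ 2) :=
          div_le_div_of_nonneg_left (by positivity) (by positivity) hAB
      _ = 2 * (1 + 4 * |x|) * (1 + t ^ 2)⁻¹ := by rw [div_eq_mul_inv]

/-- The primitive of the double-pole symmetric integrand (obtained as `−½ ∂ₓ` of the Poisson
primitive):
`x (log B − log A)/(2(1+x²)²) − ((x+t)/B + (t−x)/A)/(2(1+x²)) − (1−x²)(arctan(t−x)+arctan(t+x))/(2(1+x²)²) − x (B⁻¹ − A⁻¹)/(2(1+x²))`,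
`A = 1+(x−t)²`, `B = 1+(x+t)²`. [folklore] -/
private theorem hasDerivAt_doublePole_primitive (x t : ℝ) :
    HasDerivAt (fun t : ℝ =>
        x / (2 * (1 + x ^ 2) ^ 2) * (Real.log (1 + (x + t) ^ 2) - Real.log (1 + (x - t) ^ 2))
        - ((x + t) / (1 + (x + t) ^ 2) + (t - x) / (1 + (x - t) ^ 2)) / (2 * (1 + x ^ 2))
        - (1 - x ^ 2) / (2 * (1 + x ^ 2) ^ 2) * (Real.arctan (t - x) + Real.arctan (t + x))
        - x / (2 * (1 + x ^ 2)) * ((1 + (x + t) ^ 2)⁻¹ - (1 + (x - t) ^ 2)⁻¹))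
      (-2 * ((1 + (x - t) ^ 2) * (1 + (x + t) ^ 2) + 2 * x * (t - x) * (1 + (x + t) ^ 2)
              - 2 * x * (x + t) * (1 + (x - t) ^ 2))
        / ((1 + (x - t) ^ 2) ^ 2 * (1 + (x + t) ^ 2) ^ 2)) t := by
  have hA : 0 < 1 + (x - t) ^ 2 := by positivity
  have hB : 0 < 1 + (x + t) ^ 2 := by positivity
  have hc : (1 + x ^ 2) ≠ 0 := by positivity
  have dB : HasDerivAt (fun t : ℝ => 1 + (x + t) ^ 2) (2 * (x + t)) t := by
    have h := (((hasDerivAt_id' t).const_add x).pow 2).const_add 1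
    refine h.congr_deriv ?_
    push_cast
    ring
  have dA : HasDerivAt (fun t : ℝ => 1 + (x - t) ^ 2) (-(2 * (x - t))) t := by
    have h := (((hasDerivAt_id' t).const_sub x).pow 2).const_add 1
    refine h.congr_deriv ?_
    push_cast
    ring
  have dlogB : HasDerivAt (fun t : ℝ => Real.log (1 + (x + t) ^ 2)) (2 * (x + t) / (1 + (x + t) ^ 2)) t :=
    dB.log hB.ne'
  have dlogA : HasDerivAt (fun t : ℝ => Real.log (1 + (x - t) ^ 2))
      (-(2 * (x - t)) / (1 + (x - t) ^ 2)) t := dA.log hA.ne'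
  have dat1 : HasDerivAt (fun t : ℝ => Real.arctan (t - x)) (1 / (1 + (t - x) ^ 2) * 1) t :=
    ((hasDerivAt_id' t).sub_const x).arctan
  have dat2 : HasDerivAt (fun t : ℝ => Real.arctan (t + x)) (1 / (1 + (t + x) ^ 2) * 1) t :=
    ((hasDerivAt_id' t).add_const x).arctan
  have dq1 : HasDerivAt (fun t : ℝ => (x + t) / (1 + (x + t) ^ 2))
      ((1 * (1 + (x + t) ^ 2) - (x + t) * (2 * (x + t))) / (1 + (x + t) ^ 2) ^ 2) t :=
    ((hasDerivAt_id' t).const_add x).div dB hB.ne'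
  have dq2 : HasDerivAt (fun t : ℝ => (t - x) / (1 + (x - t) ^ 2))
      ((1 * (1 + (x - t) ^ 2) - (t - x) * (-(2 * (x - t)))) / (1 + (x - t) ^ 2) ^ 2) t :=
    ((hasDerivAt_id' t).sub_const x).div dA hA.ne'
  have diB : HasDerivAt (fun t : ℝ => (1 + (x + t) ^ 2)⁻¹) (-(2 * (x + t)) / (1 + (x + t) ^ 2) ^ 2) t :=
    dB.inv hB.ne'
  have diA : HasDerivAt (fun t : ℝ => (1 + (x - t) ^ 2)⁻¹) (-(-(2 * (x - t))) / (1 + (x - t) ^ 2) ^ 2) t :=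
    dA.inv hA.ne'
  have hsum := ((((dlogB.sub dlogA).const_mul (x / (2 * (1 + x ^ 2) ^ 2))).sub
      ((dq1.add dq2).div_const (2 * (1 + x ^ 2)))).sub
      ((dat1.add dat2).const_mul ((1 - x ^ 2) / (2 * (1 + x ^ 2) ^ 2)))).sub
      ((diB.sub diA).const_mul (x / (2 * (1 + x ^ 2))))
  refine hsum.congr_deriv ?_
  have e1 : (t - x) ^ 2 = (x - t) ^ 2 := by ring
  have e2 : (t + x) ^ 2 = (x + t) ^ 2 := by ring
  rw [e1, e2]
  field_simp
  ring

/-- **`H[y/(1+y²)²](x) = (x² − 1)/(2(1+x²)²)`**: the Hilbert transform of the double-pole profile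
`y/(1+y²)² = Re[i/(2(y+i)²)]` is `Im[i/(2(y+i)²)]`. This is the closed form used (and cited) as
`hilbProfile` in `Summits/NavierStokesRegularity/OSWSelfSimilar/SheetRowThirdExactFamily.lean` and the
test pair of the profile-sheet engines.
[cite: AmbroseLushnikovSiegelSilantyev2024, §5.2 (double-pole formulas for `ω` and `ℋω`, at `x₀ = 0`, `v_c = 1`, `ω̃ = −1/4`)] -/
theorem hilbertTransform_div_one_add_sq_sq (x : ℝ) :
    hilbertTransform (fun y => y / (1 + y ^ 2) ^ 2) x = (x ^ 2 - 1) / (2 * (1 + x ^ 2) ^ 2) := by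
  unfold hilbertTransform
  have hcongr : ∫ t in Ioi (0:ℝ), ((x - t) / (1 + (x - t) ^ 2) ^ 2 - (x + t) / (1 + (x + t) ^ 2) ^ 2) / t =
      ∫ t in Ioi (0:ℝ), -2 * ((1 + (x - t) ^ 2) * (1 + (x + t) ^ 2) + 2 * x * (t - x) * (1 + (x + t) ^ 2)
              - 2 * x * (x + t) * (1 + (x - t) ^ 2))
        / ((1 + (x - t) ^ 2) ^ 2 * (1 + (x + t) ^ 2) ^ 2) :=
    setIntegral_congr_fun measurableSet_Ioi fun t ht => doublePole_symm_integrand x (ne_of_gt ht)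
  rw [hcongr]
  set G : ℝ → ℝ := fun t =>
        x / (2 * (1 + x ^ 2) ^ 2) * (Real.log (1 + (x + t) ^ 2) - Real.log (1 + (x - t) ^ 2))
        - ((x + t) / (1 + (x + t) ^ 2) + (t - x) / (1 + (x - t) ^ 2)) / (2 * (1 + x ^ 2))
        - (1 - x ^ 2) / (2 * (1 + x ^ 2) ^ 2) * (Real.arctan (t - x) + Real.arctan (t + x))
        - x / (2 * (1 + x ^ 2)) * ((1 + (x + t) ^ 2)⁻¹ - (1 + (x - t) ^ 2)⁻¹) with hG
  have hlim : Tendsto G atTop (𝓝 (x / (2 * (1 + x ^ 2) ^ 2) * 0 - (0 + 0) / (2 * (1 + x ^ 2))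
      - (1 - x ^ 2) / (2 * (1 + x ^ 2) ^ 2) * (π / 2 + π / 2) - x / (2 * (1 + x ^ 2)) * (0 - 0))) := by
    refine ((Tendsto.sub (Tendsto.sub ?_ ?_) ?_).sub ?_)
    · exact (tendsto_log_sub_log_atTop x).const_mul _
    · refine (Tendsto.add (tendsto_lin_div_one_add_sq_atTop x) ?_).div_const _
      have h := (tendsto_lin_div_one_add_sq_atTop' x).neg
      rw [neg_zero] at h
      refine h.congr fun t => ?_
      rw [← neg_div]
      ring
    · refine Tendsto.const_mul _ (Tendsto.add ?_ ?_)
      · simpa [sub_eq_add_neg] using tendsto_arctan_add_const_atTop (-x)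
      · exact tendsto_arctan_add_const_atTop x
    · exact ((tendsto_inv_one_add_sq_shift_atTop x).sub (tendsto_inv_one_add_sq_shift_atTop' x)).const_mul _
  have hFTC := integral_Ioi_of_hasDerivAt_of_tendsto' (f := G) (a := 0)
    (fun t _ => hasDerivAt_doublePole_primitive x t)
    (integrable_doublePole_symm_integrand x).integrableOn hlim
  rw [hFTC]
  have hc : (1 + x ^ 2) ≠ 0 := by positivity
  have hG0 : G 0 = 0 := by
    simp only [hG, add_zero, sub_zero, zero_sub, zero_add, Real.arctan_neg, neg_add_cancel, mul_zero,
      sub_self]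
    field_simp
    ring
  rw [hG0]
  field_simp
  ring

/-- Dilated and scaled form of the double-pole closed form, as it enters the `c_l = 1/3` row of the
profile sheet: `H[c · f(·/ℓ)](x) = c · (Hf)(x/ℓ)` with `f(y) = y/(1+y²)²`, `ℓ > 0`.
[cite: AmbroseLushnikovSiegelSilantyev2024, §5.2 (double-pole formulas, general `v_c > 0` and amplitude)] -/
theorem hilbertTransform_doublePole_dilate (c : ℝ) {ℓ : ℝ} (hℓ : 0 < ℓ) (x : ℝ) :
    hilbertTransform (fun y => c * ((y / ℓ) / (1 + (y / ℓ) ^ 2) ^ 2)) x =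
      c * (((x / ℓ) ^ 2 - 1) / (2 * (1 + (x / ℓ) ^ 2) ^ 2)) := by
  rw [hilbertTransform_const_mul, hilbertTransform_comp_div (fun y : ℝ => y / (1 + y ^ 2) ^ 2) hℓ,
    hilbertTransform_div_one_add_sq_sq]

end Literature.Analysis.Fourier
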